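import Literature.AlgebraicGeometry.Motives.KunnethProjectorsAbelianVarieties
import Literature.AlgebraicGeometry.Motives.KatzMessingKunnethProjectors
import Literature.AlgebraicGeometry.Motives.AbelianVarietyProjectiveChart
import HarnessLib

/-!
# Künneth components of algebraic classes are algebraic under `C`

For smooth projective `X`, `Z` over `k` and a Weil cohomology theory `W`, an algebraic
correspondence `u ∈ A(X × Y)_ℚ` maps algebraic classes to algebraic classes,
`u_* (Aᵖ(X)_ℚ) ⊆ A(Y)_ℚ` (Kleiman 1968 §1.3; in the tree this is the axiom
`WeilCohomology.map_ratAlgebraicClasses_of_isInducedBy`, here repackaged for the tree's predicates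
`IsAlgebraicGradedOp` / `IsAlgebraicOperator`: `apply_mem_ratAlgebraicClasses_of_isAlgebraicGradedOp`,
`mem_ratAlgebraicClasses_of_isAlgebraicOperator`).

The Künneth projector of bidegree `(a, b)` of `X × Z`, `πᵃ_X ⊗ πᵇ_Z` (the summand of
`p^{a+b}_{h(X) ⊗ h(Z)} = Σ πⁱ_X ⊗ πʲ_Z`, Kahn 2020 Lemma 6.30 (3)), is the tree's
`tensorOp (id_{Hᵃ(X)}) (id_{Hᵇ(Z)})`; on classes it is "take the `(a, b)` Künneth component and
re-embed it", `tensorOp_id_id_apply`: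
`(id_a ⊠ id_b) z = extTensor (kunnethComponent a b z)`. It is algebraic as soon as `πᵃ_X` and `πᵇ_Z`
are (`isAlgebraicOperator_tensorOp`, Kleiman 1968 §1.3). Hence **the Künneth components of an
algebraic class on `X × Z` are algebraic whenever the Künneth projectors of `X` and `Z` in the
relevant degrees are algebraic** (`extTensor_kunnethComponent_mem_ratAlgebraicClasses`), in
particular under `C(X)` and `C(Z)`, and so unconditionally for products of curves and abelian
varieties (every `W`; `standardConjectureC_curve`, `standardConjectureC_abelianVariety`), and over a
finite field under Frobenius-through-`φ` and the Riemann hypothesis (Katz–Messing Thm. 2 (1),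
`GaloisWeilCohomology.standardConjectureC_of_weilRiemannHypothesisFor`).

Theorems only; no new definitions.

## References

* [Kleiman1968AlgebraicCycles] S. Kleiman, *Algebraic cycles and the Weil conjectures* (1968),
  §1.3 (algebraic correspondences preserve algebraic cycles; `u ⊗ v`), §2 (`C(X)`).
* [Kahn2020] B. Kahn, *Zeta and L-functions of varieties and motives* (2020), §6.9 Def. 6.29,
  Lemma 6.30 (3), Thm. 6.31 (3), Thm. 6.33.
* [KatzMessing1974] N. M. Katz, W. Messing, Invent. Math. 23 (1974), Thm. 2 (1).
-/

universe u v

open CategoryTheory AlgebraicGeometry MonoidalCategory CartesianMonoidalCategory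
open scoped TensorProduct

noncomputable section

namespace Literature.AlgebraicGeometry.Motives

namespace WeilCohomology

variable {k : Type u} [Field k] {K : Type v} [Field K] [CharZero K] (W : WeilCohomology k K)
variable {n m : ℕ} {X Y Z : SchemeOver k}

/-! ## Algebraic correspondences preserve algebraic classes -/

/-- **Algebraic correspondences preserve algebraic classes** (Kleiman 1968 §1.3), graded form: if
the graded operator `T : H•(X) → H•(Y)` is algebraic, each even component `T_{2p,2q}` maps
`Aᵖ(X)_ℚ` into `A^q(Y)_ℚ`. (The component is induced by the algebraic class `u_c`,
`2c + 2p = 2q + 2 dim X`, and the axiom `map_ratAlgebraicClasses_of_isInducedBy` applies; off these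
bidegrees the component vanishes.) [cite: Kleiman1968AlgebraicCycles, §1.3] -/
theorem apply_mem_ratAlgebraicClasses_of_isAlgebraicGradedOp (hX : IsSmoothProjective n X)
    (hY : IsSmoothProjective m Y) {T : W.GradedOp X Y} (hT : W.IsAlgebraicGradedOp n m T)
    {p : ℕ} (q : ℕ) {x : W.obj X (2 * p)} (hx : x ∈ W.ratAlgebraicClasses X p) :
    T (2 * p) (2 * q) x ∈ W.ratAlgebraicClasses Y q := by
  obtain ⟨u, hu, hzero⟩ := hT
  by_cases hc : ∃ c : ℕ, 2 * c + 2 * p = 2 * q + 2 * n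
  · obtain ⟨c, hc⟩ := hc
    by_cases hq : 2 * q ≤ 2 * m
    · exact W.map_ratAlgebraicClasses_of_isInducedBy hX hY (u c : W.obj (X ⊗ Y) (2 * c))
        (T (2 * p) (2 * q)) (show 2 * q + (2 * m - 2 * q) = 2 * m by omega)
        (show 2 * p + 2 * c + (2 * m - 2 * q) = 2 * (n + m) by omega) (u c).2
        (hu (2 * p) (2 * q) c (2 * m - 2 * q) _ _ hc) x hx
    · haveI := W.subsingleton_obj hY (show 2 * m < 2 * q by omega)
      rw [Subsingleton.elim (T (2 * p) (2 * q) x) 0]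
      exact zero_mem _
  · rw [hzero _ _ hc, LinearMap.zero_apply]
    exact zero_mem _

/-- **Algebraic correspondences preserve algebraic classes** (Kleiman 1968 §1.3): an algebraic
operator `T : H²ᵖ(X) → H²q(Y)` maps `Aᵖ(X)_ℚ` into `A^q(Y)_ℚ`. [cite: Kleiman1968AlgebraicCycles, §1.3] -/
theorem mem_ratAlgebraicClasses_of_isAlgebraicOperator (hX : IsSmoothProjective n X)
    (hY : IsSmoothProjective m Y) {p q : ℕ} {T : W.obj X (2 * p) →ₗ[K] W.obj Y (2 * q)}
    (hT : W.IsAlgebraicOperator n m T) {x : W.obj X (2 * p)} (hx : x ∈ W.ratAlgebraicClasses X p) :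
    T x ∈ W.ratAlgebraicClasses Y q := by
  have hT' : W.IsAlgebraicGradedOp n m (PreWeilCohomology.GradedOp.ofLinearMap T) := hT
  have h := W.apply_mem_ratAlgebraicClasses_of_isAlgebraicGradedOp hX hY hT' q hx
  rwa [PreWeilCohomology.GradedOp.ofLinearMap_apply_same] at h

/-! ## The Künneth projector `πᵃ_X ⊗ πᵇ_Z` on classes -/

section Components

variable {a b d : ℕ}

/-- `(id_a ⊠ id_b)` fixes the classes of bidegree `(a, b)` (the summand `pᵃ ⊗ pᵇ` of
`p^{a+b}_{M⊗N} = Σ pⁱ_M ⊗ pʲ_N` is the identity on `Hᵃ ⊗ Hᵇ`). [cite: Kahn2020, §6.9 Lemma 6.30 (3) (proof)] -/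
theorem tensorOp_id_id_extTensor_same (hX : IsSmoothProjective n X) (hZ : IsSmoothProjective m Z)
    (h : a + b = d) (t : W.obj X a ⊗[K] W.obj Z b) :
    W.tensorOp hX hZ h h (LinearMap.id : W.obj X a →ₗ[K] W.obj X a)
        (LinearMap.id : W.obj Z b →ₗ[K] W.obj Z b) (W.extTensor h t) = W.extTensor h t := by
  induction t using TensorProduct.induction_on with
  | zero => rw [map_zero, map_zero]
  | tmul x z =>
    rw [W.extTensor_tmul, W.tensorOp_externalCup_same hX hZ h h _ _ h x z]
    rfl
  | add s t hs ht => rw [map_add, map_add, hs, ht]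

/-- `(id_a ⊠ id_b)` kills the classes of the other bidegrees `(i, l) ≠ (a, b)` (the summand
`pᵃ ⊗ pᵇ` of `p^{a+b}_{M⊗N} = Σ pⁱ_M ⊗ pʲ_N` vanishes on `Hⁱ ⊗ Hˡ`). [cite: Kahn2020, §6.9 Lemma 6.30 (3) (proof)] -/
theorem tensorOp_id_id_extTensor_of_ne (hX : IsSmoothProjective n X) (hZ : IsSmoothProjective m Z)
    (h : a + b = d) {i l : ℕ} (hil : i + l = d) (hne : ¬ (i = a ∧ l = b))
    (t : W.obj X i ⊗[K] W.obj Z l) :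
    W.tensorOp hX hZ h h (LinearMap.id : W.obj X a →ₗ[K] W.obj X a)
        (LinearMap.id : W.obj Z b →ₗ[K] W.obj Z b) (W.extTensor hil t) = 0 := by
  induction t using TensorProduct.induction_on with
  | zero => rw [map_zero, map_zero]
  | tmul x z => rw [W.extTensor_tmul, W.tensorOp_externalCup_of_ne hX hZ h h _ _ hil hne x z]
  | add s t hs ht => rw [map_add, map_add, hs, ht, add_zero]

/-- **The Künneth projector of bidegree `(a, b)` on classes**: `(id_{Hᵃ(X)} ⊠ id_{Hᵇ(Z)}) z` is
the `(a, b)` Künneth component of `z` re-embedded into `Hᵃ⁺ᵇ(X × Z)`, i.e. `πᵃ_X ⊗ πᵇ_Z` is the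
projection onto the summand `Hᵃ(X) ⊗ Hᵇ(Z)` of the Künneth decomposition (Kahn 2020, proof of
Lemma 6.30: `p^k_{M⊗N} = Σ_{i+j=k} pⁱ_M ⊗ pʲ_N`). [cite: Kahn2020, §6.9 Lemma 6.30 (3) (proof)] -/
theorem tensorOp_id_id_apply (hX : IsSmoothProjective n X) (hZ : IsSmoothProjective m Z)
    (h : a + b = d) (z : W.obj (X ⊗ Z) d) :
    W.tensorOp hX hZ h h (LinearMap.id : W.obj X a →ₗ[K] W.obj X a)
        (LinearMap.id : W.obj Z b →ₗ[K] W.obj Z b) z =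
      W.extTensor h (W.kunnethComponent hX hZ a b h z) := by
  classical
  conv_lhs => rw [← W.sum_extTensor_kunnethComponent hX hZ z]
  rw [map_sum, Finset.sum_eq_single_of_mem (kIdx h) (Finset.mem_univ _)]
  · exact W.tensorOp_id_id_extTensor_same hX hZ h _
  · intro ij _ hij
    exact W.tensorOp_id_id_extTensor_of_ne hX hZ h _
      (fun hh ↦ hij (Subtype.ext (Prod.ext hh.1 hh.2))) _

/-- The Künneth components sum to the class: `z = Σ_{a+b=d} (id_a ⊠ id_b) z`, i.e.
`p^d_{M⊗N} = Σ_{a+b=d} pᵃ_M ⊗ pᵇ_N` applied to `z` (Kahn 2020, proof of Lemma 6.30; Künneth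
formula, Kleiman 1968 §1.2 (B)). [cite: Kahn2020, §6.9 Lemma 6.30 (3) (proof)] [cite: Kleiman1968AlgebraicCycles, §1.2 (B)] -/
theorem sum_tensorOp_id_id_apply (hX : IsSmoothProjective n X) (hZ : IsSmoothProjective m Z)
    (z : W.obj (X ⊗ Z) d) :
    ∑ p : ↥(Finset.antidiagonal d),
      W.tensorOp hX hZ (Finset.mem_antidiagonal.mp p.2) (Finset.mem_antidiagonal.mp p.2)
        (LinearMap.id : W.obj X p.1.1 →ₗ[K] W.obj X p.1.1)
        (LinearMap.id : W.obj Z p.1.2 →ₗ[K] W.obj Z p.1.2) z = z := by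
  rw [← LinearMap.sum_apply, W.sum_tensorOp_id hX hZ d, LinearMap.id_apply]

end Components

/-! ## Künneth components of algebraic classes -/

section Algebraic

variable {a b c : ℕ}

/-- **Künneth components of algebraic classes are algebraic when the Künneth projectors are.**
For `z ∈ Aᶜ(X × Z)_ℚ` and `a + b = 2c`: if `πᵃ_X` and `πᵇ_Z` are algebraic then the `(a, b)`
Künneth component of `z` (re-embedded in `H²ᶜ(X × Z)`) lies in `Aᶜ(X × Z)_ℚ` — it is the image of
`z` under the algebraic correspondence `πᵃ_X ⊗ πᵇ_Z` (Kleiman 1968 §1.3; Kahn 2020 Lemma 6.30 (3)).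
[cite: Kleiman1968AlgebraicCycles, §1.3] [cite: Kahn2020, §6.9 Lemma 6.30 (3)] -/
theorem extTensor_kunnethComponent_mem_ratAlgebraicClasses (hX : IsSmoothProjective n X)
    (hZ : IsSmoothProjective m Z) (h : a + b = 2 * c)
    (ha : W.IsAlgebraicOperator n n (LinearMap.id : W.obj X a →ₗ[K] W.obj X a))
    (hb : W.IsAlgebraicOperator m m (LinearMap.id : W.obj Z b →ₗ[K] W.obj Z b))
    {z : W.obj (X ⊗ Z) (2 * c)} (hz : z ∈ W.ratAlgebraicClasses (X ⊗ Z) c) :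
    W.extTensor h (W.kunnethComponent hX hZ a b h z) ∈ W.ratAlgebraicClasses (X ⊗ Z) c := by
  rw [← W.tensorOp_id_id_apply hX hZ h z]
  exact W.mem_ratAlgebraicClasses_of_isAlgebraicOperator (isSmoothProjective_tensor hX hZ)
    (isSmoothProjective_tensor hX hZ) (W.isAlgebraicOperator_tensorOp hX hZ h h ha hb) hz

/-- **Under `C(X)` and `C(Z)` all Künneth components of algebraic classes on `X × Z` are
algebraic.** [cite: Kleiman1968AlgebraicCycles, §1.3 and §2] [cite: Kahn2020, §6.9 Lemma 6.30 (3)] -/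
theorem extTensor_kunnethComponent_mem_ratAlgebraicClasses_of_standardConjectureC
    (hX : IsSmoothProjective n X) (hZ : IsSmoothProjective m Z) (hCX : W.StandardConjectureC n X)
    (hCZ : W.StandardConjectureC m Z) (h : a + b = 2 * c) {z : W.obj (X ⊗ Z) (2 * c)}
    (hz : z ∈ W.ratAlgebraicClasses (X ⊗ Z) c) :
    W.extTensor h (W.kunnethComponent hX hZ a b h z) ∈ W.ratAlgebraicClasses (X ⊗ Z) c :=
  W.extTensor_kunnethComponent_mem_ratAlgebraicClasses hX hZ h (W.standardConjectureC_iff.mp hCX a)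
    (W.standardConjectureC_iff.mp hCZ b) hz

/-- Self-products: under `C(X)` the Künneth components of algebraic classes on `X × X` are
algebraic. [cite: Kleiman1968AlgebraicCycles, §1.3 and §2] -/
theorem extTensor_kunnethComponent_mem_ratAlgebraicClasses_self (hX : IsSmoothProjective n X)
    (hCX : W.StandardConjectureC n X) (h : a + b = 2 * c) {z : W.obj (X ⊗ X) (2 * c)}
    (hz : z ∈ W.ratAlgebraicClasses (X ⊗ X) c) :
    W.extTensor h (W.kunnethComponent hX hX a b h z) ∈ W.ratAlgebraicClasses (X ⊗ X) c :=
  W.extTensor_kunnethComponent_mem_ratAlgebraicClasses_of_standardConjectureC hX hX hCX hCX h hz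

/-- **Products of curves, every `W`, unconditionally**: the Künneth components of an algebraic
class on `X × Z`, `X`, `Z` smooth projective curves, are algebraic (`C` holds for curves,
`standardConjectureC_curve`). [cite: Kahn2020, §6.9 Thm. 6.31 (1) and Lemma 6.30 (3)] -/
theorem extTensor_kunnethComponent_mem_ratAlgebraicClasses_curves (hX : IsSmoothProjective 1 X)
    (hZ : IsSmoothProjective 1 Z) (h : a + b = 2 * c) {z : W.obj (X ⊗ Z) (2 * c)}
    (hz : z ∈ W.ratAlgebraicClasses (X ⊗ Z) c) :
    W.extTensor h (W.kunnethComponent hX hZ a b h z) ∈ W.ratAlgebraicClasses (X ⊗ Z) c :=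
  W.extTensor_kunnethComponent_mem_ratAlgebraicClasses_of_standardConjectureC hX hZ
    (W.standardConjectureC_curve hX) (W.standardConjectureC_curve hZ) h hz

/-- Extreme bidegrees, unconditionally: the `(0, 2m)` Künneth component of an algebraic class in
`H^{2m}(X × Z)` (`c = m = dim Z`) is algebraic for every `W` (`π⁰_X`, `π^{2m}_Z` are algebraic,
Kahn 2020 Thm. 6.31 (1)). [cite: Kahn2020, §6.9 Thm. 6.31 (1) and Lemma 6.30 (3)] -/
theorem extTensor_kunnethComponent_zero_top_mem_ratAlgebraicClasses (hX : IsSmoothProjective n X)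
    (hZ : IsSmoothProjective m Z) (h : 0 + 2 * m = 2 * m) {z : W.obj (X ⊗ Z) (2 * m)}
    (hz : z ∈ W.ratAlgebraicClasses (X ⊗ Z) m) :
    W.extTensor h (W.kunnethComponent hX hZ 0 (2 * m) h z) ∈ W.ratAlgebraicClasses (X ⊗ Z) m :=
  W.extTensor_kunnethComponent_mem_ratAlgebraicClasses hX hZ h (W.isAlgebraicOperator_id_zero hX)
    (W.isAlgebraicOperator_id_top hZ) hz

/-- Extreme bidegrees, unconditionally: the `(2n, 0)` Künneth component of an algebraic class in
`H^{2n}(X × Z)` (`c = n = dim X`) is algebraic for every `W`. [cite: Kahn2020, §6.9 Thm. 6.31 (1) and Lemma 6.30 (3)] -/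
theorem extTensor_kunnethComponent_top_zero_mem_ratAlgebraicClasses (hX : IsSmoothProjective n X)
    (hZ : IsSmoothProjective m Z) (h : 2 * n + 0 = 2 * n) {z : W.obj (X ⊗ Z) (2 * n)}
    (hz : z ∈ W.ratAlgebraicClasses (X ⊗ Z) n) :
    W.extTensor h (W.kunnethComponent hX hZ (2 * n) 0 h z) ∈ W.ratAlgebraicClasses (X ⊗ Z) n :=
  W.extTensor_kunnethComponent_mem_ratAlgebraicClasses hX hZ h (W.isAlgebraicOperator_id_top hX)
    (W.isAlgebraicOperator_id_zero hZ) hz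

end Algebraic

/-! ## Abelian varieties (every Weil cohomology theory) -/

section AbelianVariety

variable {g g' : ℕ} (A B : AbelianVariety k) {a b c : ℕ}

/-- **Products of abelian varieties, every `W`**: the Künneth components of an algebraic class on
`A × B` are algebraic (Lieberman–Kleiman: `C` holds for abelian varieties,
`standardConjectureC_abelianVariety`). [cite: Kleiman1968AlgebraicCycles, Appendix to §2, Thm. 2A11]
[cite: Kahn2020, §6.9 Thm. 6.31 (3) and Lemma 6.30 (3)] -/
theorem extTensor_kunnethComponent_mem_ratAlgebraicClasses_abelianVariety
    (hA : IsSmoothProjective g A.X) (hB : IsSmoothProjective g' B.X) (h : a + b = 2 * c)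
    {z : W.obj (A.X ⊗ B.X) (2 * c)} (hz : z ∈ W.ratAlgebraicClasses (A.X ⊗ B.X) c) :
    W.extTensor h (W.kunnethComponent hA hB a b h z) ∈ W.ratAlgebraicClasses (A.X ⊗ B.X) c :=
  W.extTensor_kunnethComponent_mem_ratAlgebraicClasses_of_standardConjectureC hA hB
    (W.standardConjectureC_abelianVariety A hA) (W.standardConjectureC_abelianVariety B hB) h hz

/-- The same with no hypothesis at all, in the dimensions `dim A`, `dim B`
(`AbelianVariety.isSmoothProjective_holds`). [cite: Kleiman1968AlgebraicCycles, Appendix to §2, Thm. 2A11]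
[cite: Kahn2020, §6.9 Thm. 6.31 (3) and Lemma 6.30 (3)] -/
theorem extTensor_kunnethComponent_mem_ratAlgebraicClasses_abelianVariety_dim (h : a + b = 2 * c)
    {z : W.obj (A.X ⊗ B.X) (2 * c)} (hz : z ∈ W.ratAlgebraicClasses (A.X ⊗ B.X) c) :
    W.extTensor h (W.kunnethComponent
        (AbelianVariety.isSmoothProjective_holds (A := A) : IsSmoothProjective A.dim A.X)
        (AbelianVariety.isSmoothProjective_holds (A := B) : IsSmoothProjective B.dim B.X) a b h z) ∈
      W.ratAlgebraicClasses (A.X ⊗ B.X) c :=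
  W.extTensor_kunnethComponent_mem_ratAlgebraicClasses_abelianVariety A B _ _ h hz

/-- `A × Z` with `C(Z)`, every `W`: Künneth components of algebraic classes are algebraic.
[cite: Kahn2020, §6.9 Thm. 6.31 (3) and Lemma 6.30 (3)] -/
theorem extTensor_kunnethComponent_mem_ratAlgebraicClasses_abelianVariety_tensor
    (hA : IsSmoothProjective g A.X) (hZ : IsSmoothProjective m Z) (hCZ : W.StandardConjectureC m Z)
    (h : a + b = 2 * c) {z : W.obj (A.X ⊗ Z) (2 * c)} (hz : z ∈ W.ratAlgebraicClasses (A.X ⊗ Z) c) :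
    W.extTensor h (W.kunnethComponent hA hZ a b h z) ∈ W.ratAlgebraicClasses (A.X ⊗ Z) c :=
  W.extTensor_kunnethComponent_mem_ratAlgebraicClasses_of_standardConjectureC hA hZ
    (W.standardConjectureC_abelianVariety A hA) hCZ h hz

/-- `A × X` with `X` a curve, every `W`, unconditionally. [cite: Kahn2020, §6.9 Thm. 6.31 (1), (3) and Lemma 6.30 (3)] -/
theorem extTensor_kunnethComponent_mem_ratAlgebraicClasses_abelianVariety_tensor_curve
    (hA : IsSmoothProjective g A.X) (hX : IsSmoothProjective 1 X) (h : a + b = 2 * c)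
    {z : W.obj (A.X ⊗ X) (2 * c)} (hz : z ∈ W.ratAlgebraicClasses (A.X ⊗ X) c) :
    W.extTensor h (W.kunnethComponent hA hX a b h z) ∈ W.ratAlgebraicClasses (A.X ⊗ X) c :=
  W.extTensor_kunnethComponent_mem_ratAlgebraicClasses_abelianVariety_tensor A hA hX
    (W.standardConjectureC_curve hX) h hz

end AbelianVariety

end WeilCohomology

/-! ## Finite fields -/

namespace GaloisWeilCohomology

variable {k : Type u} [Field k] [Finite k] {K : Type v} [Field K] [CharZero K]
  {χ : Field.absoluteGaloisGroup k →* Kˣ} (E : GaloisWeilCohomology k K χ)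
variable {n m : ℕ} {X Z : SchemeOver k} {a b c : ℕ}

/-- **Over a finite field** (Katz–Messing Thm. 2 (1): `C` holds): for `X`, `Z` smooth projective
over the finite field `k` with the geometric Frobenius acting through `k`-endomorphisms `φ_X`,
`φ_Z` and the Riemann hypothesis for both, the Künneth components of every algebraic class on
`X × Z` are algebraic. [cite: KatzMessing1974, Thm. 2 (1)] [cite: Kahn2020, §6.9 Thm. 6.33 and Lemma 6.30 (3)] -/
theorem extTensor_kunnethComponent_mem_ratAlgebraicClasses_of_weilRiemannHypothesisFor
    (hX : IsSmoothProjective n X) (hZ : IsSmoothProjective m Z) (φX : X ⟶ X)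
    (hφX : ∀ i : ℕ, E.frobAction X i = E.pullback φX i) (hRHX : E.WeilRiemannHypothesisFor X n)
    (φZ : Z ⟶ Z) (hφZ : ∀ i : ℕ, E.frobAction Z i = E.pullback φZ i)
    (hRHZ : E.WeilRiemannHypothesisFor Z m) (h : a + b = 2 * c) {z : E.obj (X ⊗ Z) (2 * c)}
    (hz : z ∈ E.ratAlgebraicClasses (X ⊗ Z) c) :
    E.extTensor h (E.kunnethComponent hX hZ a b h z) ∈ E.ratAlgebraicClasses (X ⊗ Z) c :=
  E.extTensor_kunnethComponent_mem_ratAlgebraicClasses_of_standardConjectureC hX hZ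
    (E.standardConjectureC_of_weilRiemannHypothesisFor hX φX hφX hRHX)
    (E.standardConjectureC_of_weilRiemannHypothesisFor hZ φZ hφZ hRHZ) h hz

/-- Self-products over a finite field: `X × X`, one Frobenius hypothesis. [cite: KatzMessing1974, Thm. 2 (1)] -/
theorem extTensor_kunnethComponent_mem_ratAlgebraicClasses_self_of_weilRiemannHypothesisFor
    (hX : IsSmoothProjective n X) (φ : X ⟶ X) (hφ : ∀ i : ℕ, E.frobAction X i = E.pullback φ i)
    (hRH : E.WeilRiemannHypothesisFor X n) (h : a + b = 2 * c) {z : E.obj (X ⊗ X) (2 * c)}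
    (hz : z ∈ E.ratAlgebraicClasses (X ⊗ X) c) :
    E.extTensor h (E.kunnethComponent hX hX a b h z) ∈ E.ratAlgebraicClasses (X ⊗ X) c :=
  E.extTensor_kunnethComponent_mem_ratAlgebraicClasses_of_weilRiemannHypothesisFor hX hX φ hφ hRH φ
    hφ hRH h hz

end GaloisWeilCohomology

end Literature.AlgebraicGeometry.Motives

end
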